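import Mathlib
import HarnessLib
import HarnessLib.Audit
import Summits.ValiantsHypothesis.ValiantsHypothesis.Theorems.LacunarySymmetroidMatrixDescartesMiddleBinomial
import Summits.ValiantsHypothesis.ValiantsHypothesis.Theorems.LacunarySymmetroidMatrixDescartesDipWindow

/-!
# ValiantsHypothesis / LacunarySymmetroid — crux `MatrixDescartes` (stmt-ValiantsHypothesis-18050, V1), LINE (A) «product_plus_one»:
# the MULTIPLIER QUOTIENT `F̂` PACKAGED with its derivative `F̂′ = Λ·J` (kit for Theorem C's tangential case and for T3♯ sign-change counting)

✓ `…MultiplierQuotient` exposes only the Rolle consequence (`J` vanishes between critical points), which bounds the number of critical points by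
`1 + #zeros(J)`.  The sharper count `1 + #(sign changes of J)` — needed for crit-1 #411 THEOREM C (`≤ 3` for identical rows; ✓ `identicalRowsAtMostFour`
stops at the tangential zero) and for the pen's T3♯ — needs `F̂` itself: on a stretch where `J` keeps one sign, `F̂` is strictly monotone (mean
value theorem with `F̂′ = Λ·J`, `Λ < 0`).  `exists_multiplierQuotient` packages exactly these facts (existence form; `F̂ = (1 + gψ_B/G)/B`,
`Λ = gψ_B/(tBG)`, `J = V/ψ_B − ψ_B − G₂/G` written out as in the engine).
HONEST FRAMING: kit/helper; closes no stub; `OneChangeFloorK3`, `MatrixDescartes` OPEN; `VP ≠ VNP` is NOT proved.  No definitions, no named facts, no sorry.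
-/

set_option linter.dupNamespace false

namespace Summit.ValiantsHypothesis.ValiantsHypothesis.Theorems.LacunarySymmetroidMatrixDescartes

namespace ZeroChange

open Polynomial Finset Set

/-- ★ **THE MULTIPLIER QUOTIENT, PACKAGED** (for sign-change counting: Theorem C's tangential case, T3♯).  For one W row `(−α, κ, γ)`
(`κ ≥ 0 < γ`) and a zero-change block with some non-constant row there are functions `F` (the multiplier quotient `(1 + gψ_B/G)/B`) and `Λ`
(`= gψ_B/(tBG)`) on `(0,∞)` such that: `F` vanishes at every positive critical point of the product; `F′ = Λ·J` with `J` the explicit rate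
function of ✓ `exists_rateJ_zero_between_crit`; `Λ < 0` wherever the W row is negative; and the W row IS negative at every positive critical
point and is non-decreasing.  (So on a stretch left of a critical point where `J > 0`, `F` is strictly decreasing — mean value theorem.) -/
theorem exists_multiplierQuotient (k a c : ℕ) (ha : 0 < a) (hac : a < c) (α κ γ : ℝ) (p q s : Fin k → ℝ)
    (hκ : 0 ≤ κ) (hγ : 0 < γ) (h : ∀ i, 0 ≤ p i ∧ 0 ≤ q i ∧ 0 ≤ s i ∧ 0 < p i + q i + s i) (hns : ∃ i, 0 < q i ∨ 0 < s i) :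
    ∃ F Λ : ℝ → ℝ,
      (∀ t, 0 < t → (derivative (row a c (-α) κ γ * ∏ i, row a c (p i) (q i) (s i))).eval t = 0 →
          F t = 0 ∧ -α + κ * t ^ a + γ * t ^ c < 0) ∧
      (∀ t, 0 < t → HasDerivAt F (Λ t *
          ((∑ i, (((a : ℝ) ^ 2 * q i * t ^ a + (c : ℝ) ^ 2 * s i * t ^ c) / (p i + q i * t ^ a + s i * t ^ c)
              - (((a : ℝ) * q i * t ^ a + (c : ℝ) * s i * t ^ c) / (p i + q i * t ^ a + s i * t ^ c)) ^ 2)) /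
            (∑ i, ((a : ℝ) * q i * t ^ a + (c : ℝ) * s i * t ^ c) / (p i + q i * t ^ a + s i * t ^ c))
          - (∑ i, ((a : ℝ) * q i * t ^ a + (c : ℝ) * s i * t ^ c) / (p i + q i * t ^ a + s i * t ^ c))
          - ((a : ℝ) ^ 2 * κ * t ^ a + (c : ℝ) ^ 2 * γ * t ^ c) / ((a : ℝ) * κ * t ^ a + (c : ℝ) * γ * t ^ c))) t) ∧
      (∀ t, 0 < t → -α + κ * t ^ a + γ * t ^ c < 0 → Λ t < 0) ∧
      (∀ t t', 0 ≤ t → t ≤ t' → -α + κ * t ^ a + γ * t ^ c ≤ -α + κ * t' ^ a + γ * t' ^ c) := by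
  classical
  have hc : 0 < c := ha.trans hac
  have ha' : (0 : ℝ) < a := by exact_mod_cast ha
  have hc' : (0 : ℝ) < c := by exact_mod_cast hc
  -- the polynomial objects
  set gW : ℝ[X] := row a c (-α) κ γ with hgW
  set B : ℝ[X] := ∏ i, row a c (p i) (q i) (s i) with hB
  -- the real functions of the proof
  obtain ⟨P, hP⟩ : ∃ P : Fin k → ℝ → ℝ, ∀ i t, P i t = p i + q i * t ^ a + s i * t ^ c := ⟨_, fun _ _ => rfl⟩
  obtain ⟨N, hN⟩ : ∃ N : Fin k → ℝ → ℝ, ∀ i t, N i t = (a : ℝ) * q i * t ^ a + (c : ℝ) * s i * t ^ c :=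
    ⟨_, fun _ _ => rfl⟩
  obtain ⟨M, hM⟩ : ∃ M : Fin k → ℝ → ℝ, ∀ i t, M i t = (a : ℝ) ^ 2 * q i * t ^ a + (c : ℝ) ^ 2 * s i * t ^ c :=
    ⟨_, fun _ _ => rfl⟩
  obtain ⟨ψ, hψ⟩ : ∃ ψ : Fin k → ℝ → ℝ, ∀ i t, ψ i t = N i t / P i t := ⟨_, fun _ _ => rfl⟩
  obtain ⟨ψB, hψB⟩ : ∃ ψB : ℝ → ℝ, ∀ t, ψB t = ∑ i, ψ i t := ⟨_, fun _ => rfl⟩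
  obtain ⟨V, hV⟩ : ∃ V : ℝ → ℝ, ∀ t, V t = ∑ i, (M i t / P i t - ψ i t ^ 2) := ⟨_, fun _ => rfl⟩
  obtain ⟨g, hg⟩ : ∃ g : ℝ → ℝ, ∀ t, g t = -α + κ * t ^ a + γ * t ^ c := ⟨_, fun _ => rfl⟩
  obtain ⟨G, hG⟩ : ∃ G : ℝ → ℝ, ∀ t, G t = (a : ℝ) * κ * t ^ a + (c : ℝ) * γ * t ^ c := ⟨_, fun _ => rfl⟩
  obtain ⟨G₂, hG₂⟩ : ∃ G₂ : ℝ → ℝ, ∀ t, G₂ t = (a : ℝ) ^ 2 * κ * t ^ a + (c : ℝ) ^ 2 * γ * t ^ c :=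
    ⟨_, fun _ => rfl⟩
  obtain ⟨Bf, hBf⟩ : ∃ Bf : ℝ → ℝ, ∀ t, Bf t = ∏ i, P i t := ⟨_, fun _ => rfl⟩
  obtain ⟨J, hJ⟩ : ∃ J : ℝ → ℝ, ∀ t, J t = V t / ψB t - ψB t - G₂ t / G t := ⟨_, fun _ => rfl⟩
  obtain ⟨F, hF⟩ : ∃ F : ℝ → ℝ, ∀ t, F t = (1 + g t * ψB t / G t) / Bf t := ⟨_, fun _ => rfl⟩
  -- elementary facts
  have hPpos : ∀ i t, 0 < t → 0 < P i t := fun i t ht => by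
    rw [hP]
    obtain ⟨hp, hq, hs, hsum⟩ := h i
    have h1 : 0 ≤ q i * t ^ a := mul_nonneg hq (pow_pos ht a).le
    have h2 : 0 ≤ s i * t ^ c := mul_nonneg hs (pow_pos ht c).le
    rcases hp.eq_or_lt with h0 | h0
    · rcases hq.eq_or_lt with h0' | h0'
      · have : 0 < s i := by linarith
        have : 0 < s i * t ^ c := mul_pos this (pow_pos ht c)
        linarith
      · have : 0 < q i * t ^ a := mul_pos h0' (pow_pos ht a)
        linarith
    · linarith
  have hProw : ∀ i t, (row a c (p i) (q i) (s i)).eval t = P i t := fun i t => by simp [eval_row, hP]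
  have hgrow : ∀ t, gW.eval t = g t := fun t => by simp [hgW, eval_row, hg]
  have hBev : ∀ t, B.eval t = Bf t := fun t => by
    rw [hB, eval_prod, hBf]; exact prod_congr rfl fun i _ => hProw i t
  have hBpos : ∀ t, 0 < t → 0 < Bf t := fun t ht => by
    rw [hBf]; exact prod_pos fun i _ => hPpos i t ht
  have hGpos : ∀ t, 0 < t → 0 < G t := fun t ht => by
    rw [hG]; exact add_pos_of_nonneg_of_pos (by positivity) (by positivity)
  have hNnn : ∀ i t, 0 < t → 0 ≤ N i t := fun i t ht => by
    rw [hN]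
    exact add_nonneg (mul_nonneg (mul_nonneg ha'.le (h i).2.1) (pow_pos ht a).le)
      (mul_nonneg (mul_nonneg hc'.le (h i).2.2.1) (pow_pos ht c).le)
  have hψnn : ∀ i t, 0 < t → 0 ≤ ψ i t := fun i t ht => by
    rw [hψ]; exact div_nonneg (hNnn i t ht) (hPpos i t ht).le
  have hψBnn : ∀ t, 0 < t → 0 ≤ ψB t := fun t ht => by
    rw [hψB]; exact sum_nonneg fun i _ => hψnn i t ht
  have hgmono : ∀ t t', 0 ≤ t → t ≤ t' → g t ≤ g t' := fun t t' ht htt => by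
    rw [← hgrow, ← hgrow, hgW]; exact eval_row_mono _ hκ hγ.le ht htt
  -- `t·B′(t) = B(t)·ψ_B(t)` and `t·g′(t) = G(t)`
  have hBder : ∀ t, 0 < t → (derivative B).eval t = Bf t * (ψB t / t) := by
    intro t ht
    have hprodder : (derivative (∏ i, row a c (p i) (q i) (s i))).eval t =
        (∏ i, row a c (p i) (q i) (s i)).eval t *
          ∑ i, (derivative (row a c (p i) (q i) (s i))).eval t / (row a c (p i) (q i) (s i)).eval t := by
      have := eval_derivative_prod_rows k a c (fun i => (p i, q i, s i)) (x := t)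
        (fun j => by simpa [hProw] using (hPpos j t ht).ne')
      simpa using this
    have hsum : t * ∑ i, (derivative (row a c (p i) (q i) (s i))).eval t / (row a c (p i) (q i) (s i)).eval t
        = ∑ i, ψ i t := by
      rw [mul_sum]
      refine sum_congr rfl fun i _ => ?_
      rw [mul_div_assoc', mul_eval_derivative_row, hProw, hψ, hN]
    rw [mul_div_assoc', eq_div_iff ht.ne', hB, hprodder, ← hB, hBev, hψB, ← hsum]
    ring
  have hgWder : ∀ t, t * (derivative gW).eval t = G t := fun t => by
    rw [hgW, mul_eval_derivative_row, hG]
  -- the link `t·Φ′(t) = B(t)·(G(t) + g(t)·ψ_B(t))`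
  have hlink : ∀ t, 0 < t →
      t * (derivative (gW * B)).eval t = Bf t * (G t + g t * ψB t) := by
    intro t ht
    rw [derivative_mul, eval_add,
      show (derivative gW * B).eval t = (derivative gW).eval t * B.eval t from eval_mul,
      show (gW * derivative B).eval t = gW.eval t * (derivative B).eval t from eval_mul, hBder t ht, hgrow, hBev]
    calc t * ((derivative gW).eval t * Bf t + g t * (Bf t * (ψB t / t)))
        = (t * (derivative gW).eval t) * Bf t + g t * Bf t * ψB t * (t / t) := by ring
      _ = Bf t * (G t + g t * ψB t) := by rw [hgWder, div_self ht.ne']; ring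
  -- at a positive critical point: `G + g·ψ_B = 0`, hence `g < 0 < ψ_B` and `F = 0`
  have hcrit : ∀ t, 0 < t → (derivative (gW * B)).eval t = 0 → g t < 0 ∧ 0 < ψB t ∧ F t = 0 := by
    intro t ht hD
    have h0 : G t + g t * ψB t = 0 := by
      have := hlink t ht
      rw [hD, mul_zero] at this
      rcases mul_eq_zero.1 this.symm with h1 | h1
      · exact absurd h1 (hBpos t ht).ne'
      · exact h1
    have hgS : g t * ψB t < 0 := by linarith [hGpos t ht]
    have hS : 0 < ψB t := by
      rcases (hψBnn t ht).eq_or_lt with h1 | h1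
      · rw [← h1, mul_zero] at hgS; exact absurd hgS (lt_irrefl _)
      · exact h1
    have hgt : g t < 0 := by
      rcases lt_or_ge (g t) 0 with h1 | h1
      · exact h1
      · nlinarith [mul_nonneg h1 hS.le]
    refine ⟨hgt, hS, ?_⟩
    have e : g t * ψB t = -G t := by linarith
    rw [hF, e, neg_div, div_self (hGpos t ht).ne', add_neg_cancel, zero_div]
  -- `ψ_B > 0` everywhere (some row is non-constant)
  have hψBpos : ∀ t, 0 < t → 0 < ψB t := by
    obtain ⟨i, hqs⟩ := hns
    intro t ht
    have hNi : 0 < N i t := by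
      rw [hN]
      rcases hqs with h1 | h1
      · exact add_pos_of_pos_of_nonneg (by positivity) (mul_nonneg (mul_nonneg hc'.le (h i).2.2.1) (pow_pos ht c).le)
      · exact add_pos_of_nonneg_of_pos (mul_nonneg (mul_nonneg ha'.le (h i).2.1) (pow_pos ht a).le) (by positivity)
    have hψi : 0 < ψ i t := by rw [hψ]; exact div_pos hNi (hPpos i t ht)
    rw [hψB]
    exact lt_of_lt_of_le hψi (single_le_sum (f := fun j => ψ j t) (fun j _ => hψnn j t ht) (mem_univ i))
  -- the derivative of `F` on `(0,∞)`
  have hFd : ∀ t, 0 < t → HasDerivAt F (g t * ψB t / (t * Bf t * G t) * J t) t := by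
    intro t ht
    have ht0 : t ≠ 0 := ht.ne'
    have hpowa : (a : ℝ) * t ^ (a - 1) = (a : ℝ) * t ^ a / t := by
      rw [eq_div_iff ht0, mul_assoc, ← pow_succ, Nat.sub_add_cancel (show 1 ≤ a from ha)]
    have hpowc : (c : ℝ) * t ^ (c - 1) = (c : ℝ) * t ^ c / t := by
      rw [eq_div_iff ht0, mul_assoc, ← pow_succ, Nat.sub_add_cancel (show 1 ≤ c from hc)]
    have hrow : ∀ u v w : ℝ, HasDerivAt (fun x => u + v * x ^ a + w * x ^ c)
        (((a : ℝ) * v * t ^ a + (c : ℝ) * w * t ^ c) / t) t := by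
      intro u v w
      refine ((((hasDerivAt_pow a t).const_mul v).const_add u).fun_add
        ((hasDerivAt_pow c t).const_mul w)).congr_deriv ?_
      have e1 : v * ((a : ℝ) * t ^ (a - 1)) = (a : ℝ) * v * t ^ a / t := by rw [hpowa]; ring
      have e2 : w * ((c : ℝ) * t ^ (c - 1)) = (c : ℝ) * w * t ^ c / t := by rw [hpowc]; ring
      rw [e1, e2]; ring
    have hrow0 : ∀ v w : ℝ, HasDerivAt (fun x => v * x ^ a + w * x ^ c)
        (((a : ℝ) * v * t ^ a + (c : ℝ) * w * t ^ c) / t) t := by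
      intro v w
      refine (((hasDerivAt_pow a t).const_mul v).fun_add ((hasDerivAt_pow c t).const_mul w)).congr_deriv ?_
      have e1 : v * ((a : ℝ) * t ^ (a - 1)) = (a : ℝ) * v * t ^ a / t := by rw [hpowa]; ring
      have e2 : w * ((c : ℝ) * t ^ (c - 1)) = (c : ℝ) * w * t ^ c / t := by rw [hpowc]; ring
      rw [e1, e2]; ring
    have hPd : ∀ i, HasDerivAt (P i) (N i t / t) t := by
      intro i
      refine ((hrow (p i) (q i) (s i)).congr_of_eventuallyEq (Filter.Eventually.of_forall (hP i))).congr_deriv ?_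
      rw [hN]
    have hNd : ∀ i, HasDerivAt (N i) (M i t / t) t := by
      intro i
      refine ((hrow0 ((a : ℝ) * q i) ((c : ℝ) * s i)).congr_of_eventuallyEq
        (Filter.Eventually.of_forall (hN i))).congr_deriv ?_
      rw [hM]; ring
    have hψd : ∀ i, HasDerivAt (ψ i) ((M i t / P i t - ψ i t ^ 2) / t) t := by
      intro i
      have h1 := (hNd i).fun_div (hPd i) (hPpos i t ht).ne'
      refine (h1.congr_of_eventuallyEq (Filter.Eventually.of_forall (hψ i))).congr_deriv ?_
      have hP0 : P i t ≠ 0 := (hPpos i t ht).ne'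
      rw [hψ]
      field_simp
    have hψBd : HasDerivAt ψB (V t / t) t := by
      have h1 : HasDerivAt (fun x => ∑ i, ψ i x) (∑ i, (M i t / P i t - ψ i t ^ 2) / t) t :=
        HasDerivAt.fun_sum (u := univ) (fun i _ => hψd i)
      refine (h1.congr_of_eventuallyEq (Filter.Eventually.of_forall hψB)).congr_deriv ?_
      rw [hV, sum_div]
    have hgd : HasDerivAt g (G t / t) t := by
      refine ((hrow (-α) κ γ).congr_of_eventuallyEq (Filter.Eventually.of_forall hg)).congr_deriv ?_
      rw [hG]
    have hGd : HasDerivAt G (G₂ t / t) t := by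
      refine ((hrow0 ((a : ℝ) * κ) ((c : ℝ) * γ)).congr_of_eventuallyEq
        (Filter.Eventually.of_forall hG)).congr_deriv ?_
      rw [hG₂]; ring
    have hBfd : HasDerivAt Bf (Bf t * (ψB t / t)) t :=
      ((B.hasDerivAt t).congr_of_eventuallyEq (Filter.Eventually.of_forall fun x => (hBev x).symm)).congr_deriv
        (hBder t ht)
    -- assemble
    have h1 := (hgd.fun_mul hψBd).fun_div hGd (hGpos t ht).ne'
    have h2 := (h1.const_add 1).fun_div hBfd (hBpos t ht).ne'
    refine (h2.congr_of_eventuallyEq (Filter.Eventually.of_forall hF)).congr_deriv ?_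
    have hB0 : Bf t ≠ 0 := (hBpos t ht).ne'
    have hG0 : G t ≠ 0 := (hGpos t ht).ne'
    have hS0 : ψB t ≠ 0 := (hψBpos t ht).ne'
    rw [hJ]
    field_simp
    ring
  obtain ⟨Λ, hΛ⟩ : ∃ Λ : ℝ → ℝ, ∀ t, Λ t = g t * ψB t / (t * Bf t * G t) := ⟨_, fun _ => rfl⟩
  have hJfun : ∀ t, J t =
      (∑ i, (((a : ℝ) ^ 2 * q i * t ^ a + (c : ℝ) ^ 2 * s i * t ^ c) / (p i + q i * t ^ a + s i * t ^ c)
          - (((a : ℝ) * q i * t ^ a + (c : ℝ) * s i * t ^ c) / (p i + q i * t ^ a + s i * t ^ c)) ^ 2)) /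
        (∑ i, ((a : ℝ) * q i * t ^ a + (c : ℝ) * s i * t ^ c) / (p i + q i * t ^ a + s i * t ^ c))
      - (∑ i, ((a : ℝ) * q i * t ^ a + (c : ℝ) * s i * t ^ c) / (p i + q i * t ^ a + s i * t ^ c))
      - ((a : ℝ) ^ 2 * κ * t ^ a + (c : ℝ) ^ 2 * γ * t ^ c) / ((a : ℝ) * κ * t ^ a + (c : ℝ) * γ * t ^ c) := by
    intro t
    rw [hJ, hV, hψB, hG₂, hG]
    simp only [hψ, hM, hN, hP]
  refine ⟨F, Λ, ?_, ?_, ?_, ?_⟩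
  · intro t ht hD
    obtain ⟨hglt, -, hF0⟩ := hcrit t ht hD
    exact ⟨hF0, by rw [← hg]; exact hglt⟩
  · intro t ht
    rw [← hJfun t, hΛ]
    exact hFd t ht
  · intro t ht hgt
    have hgt' : g t < 0 := by rw [hg]; exact hgt
    rw [hΛ]
    exact div_neg_of_neg_of_pos (mul_neg_of_neg_of_pos hgt' (hψBpos t ht))
      (mul_pos (mul_pos ht (hBpos t ht)) (hGpos t ht))
  · intro t t' ht htt
    have := hgmono t t' ht htt
    rw [hg, hg] at this
    exact this

end ZeroChange

end Summit.ValiantsHypothesis.ValiantsHypothesis.Theorems.LacunarySymmetroidMatrixDescartes
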